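import Summits.HodgeConjecture.HodgeConjecture.Theorems.Q8BireflectionRecognitionRelative
import Literature.AlgebraicTopology.SingularHomology.PoincareDuality
import Literature.AlgebraicGeometry.HodgeTheory.ComplexOrientationIsomorphism
import HarnessLib

/-!
# Route `Q8SymplecticPowers`, crux K1Q — stub S5 (v6, purely local currency) from the HOMOLOGICAL two-ball datum of a d6 meridian,
# through a duality isomorphism `D : H² ≃ H₂` (the algebra of brick L6-6)

Support file for crux K1Q (stmt-HodgeConjecture-24190; `--supports … --as helper`). Prover seat `hodge-nonav-prover-Ax` (g18).
Sequel of `Q8BireflectionRecognitionRelative` (`exists_bireflection_datum_of_localMonodromy_sq`: S5-v6's ∃-clause from COHOMOLOGICAL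
planes `V₁, V₂ ≤ ker(A² + 1)`). The geometric bricks produce HOMOLOGY: the two-ball localisation
(`Literature.AlgebraicTopology.SingularHomology.HomologySelfMapTwoLocalPieces`) gives `W₁, W₂ ≤ H₂(X_s; ℚ)` (images of `H₂` of the two
ball pieces) with `h_* y − y ∈ W₁ ⊔ W₂`, `h_* = τ_*` on `W₁`, `h_* τ_* = 1` on `W₂`; the local package
(`Literature.Geometry.ComplexAnalytic.PhamBrieskornA3Involution*`) gives `τ_*² = −1` on `W_k` and `dim W_k = 2`; the deck involution
`j` exchanges the balls (`j_* W₁ ⊆ W₂`, `j_* W₂ ⊆ W₁`); Poincaré duals of classes carried by the disjoint balls pair to zero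
(`cupPairing_eq_zero_of_disjoint_carriers`). This file is the LINEAR ALGEBRA that turns such a datum into the hypotheses of
`exists_bireflection_datum_of_localMonodromy_sq`, given ANY linear isomorphism `D : H ≃ H_h` ("Poincaré duality") intertwining
`A = τ^*` with `τ_*⁻¹`, `B = j^*` with `j_*⁻¹` and `γ` with `h_*⁻¹` (`τ_* D A = D`, `j_* D B = D`, `h_* D γ = D` — naturality of the cap
product for orientation-preserving homeomorphisms):

* §1 stable subspaces of automorphisms (`map_eq_of_mapsTo`, `symm_mem_of_mapsTo`), pulled-back planes `V_k := D⁻¹(W_k)`.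
* §2 **`exists_bireflection_datum_of_homological_datum`** — conclusion = S5-v6's ∃-clause VERBATIM for
  `W := Module.End.eigenspace (A ^ 2) (−1)` (memberships and fixing-clause domain `(eigenspace (A^2) (−1)).baseChange L`).

What remains GEOMETRIC after this file (memo `memos/LOC6-ARCHITECTURE-Ax-g18.md` §4): the chart at `p` (L6-2), the geometric monodromy
homeomorphism `h` (L6-4), the local piece `F°∕ι` and the rank `2` of `W_k` in `H₂(X_s)` (L6-5∕6(i)), the duality `D` with its three
naturality squares and the disjoint-carrier orthogonality in the tree's `bettiCohomology` currency (L6-6(ii)(iii)).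
HONEST FRAMING: linear algebra only (axioms standard, no named fact); K1Q ∕ HC NOT proved; item 24190 OPEN.
-/

noncomputable section

set_option linter.dupNamespace false

namespace Summit.HodgeConjecture.HodgeConjecture.Theorems.Q8BireflectionRecognitionHomological

open Module
open Summit.HodgeConjecture.HodgeConjecture.Theorems.Q8BireflectionRecognitionRelative
open LinearMap (BilinForm)
open scoped TensorProduct

variable {K : Type*} [Field K] {M : Type*} [AddCommGroup M] [Module K M]

/-! ### §1 Stable subspaces of automorphisms -/

/-- A finite-dimensional subspace mapped into itself by an automorphism is mapped ONTO itself. -/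
theorem map_eq_of_mapsTo (e : M ≃ₗ[K] M) (W : Submodule K M) [FiniteDimensional K W] (h : ∀ w ∈ W, e w ∈ W) :
    W.map (e : M →ₗ[K] M) = W :=
  Submodule.eq_of_le_of_finrank_eq (by rintro _ ⟨w, hw, rfl⟩; exact h w hw) (LinearEquiv.finrank_map_eq e W)

/-- Hence the inverse automorphism also preserves it. -/
theorem symm_mem_of_mapsTo (e : M ≃ₗ[K] M) (W : Submodule K M) [FiniteDimensional K W] (h : ∀ w ∈ W, e w ∈ W) :
    ∀ w ∈ W, e.symm w ∈ W := by
  intro w hw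
  rw [← map_eq_of_mapsTo e W h] at hw
  obtain ⟨w', hw', rfl⟩ := hw
  rw [LinearEquiv.coe_coe, LinearEquiv.symm_apply_apply]
  exact hw'

/-- If an automorphism maps `W₂` into `W₁` and both have the same finite dimension, then `e⁻¹` maps `W₁` into `W₂`. -/
theorem symm_mem_of_mapsTo_of_finrank_eq (e : M ≃ₗ[K] M) (W₁ W₂ : Submodule K M) [FiniteDimensional K W₁] [FiniteDimensional K W₂]
    (h : ∀ w ∈ W₂, e w ∈ W₁) (hd : finrank K W₁ = finrank K W₂) : ∀ w ∈ W₁, e.symm w ∈ W₂ := by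
  have hmap : W₂.map (e : M →ₗ[K] M) = W₁ :=
    Submodule.eq_of_le_of_finrank_eq (by rintro _ ⟨w, hw, rfl⟩; exact h w hw) (by rw [LinearEquiv.finrank_map_eq, hd])
  intro w hw
  rw [← hmap] at hw
  obtain ⟨w', hw', rfl⟩ := hw
  rw [LinearEquiv.coe_coe, LinearEquiv.symm_apply_apply]
  exact hw'

/-! ### §2 S5-v6 from the homological datum -/

section Homological

variable {L : Type*} [Field L] [CharZero L] [Algebra K L] {H : Type*} [AddCommGroup H] [Module K H] [FiniteDimensional K H]
  {Hh : Type*} [AddCommGroup Hh] [Module K Hh] [FiniteDimensional K Hh]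

/-- **Stub S5 (v6 currency) from the homological two-ball datum through a duality isomorphism.**
COHOMOLOGY SIDE (`H = H²(X_s; ℚ)`): `Q` symmetric non-degenerate (Poincaré); `A = τ^*`, `B = j^*` `Q`-isometries with `A⁴ = 1`,
`B A² = A² B`; `γ` (the transport, or its inverse) a `Q`-isometric automorphism commuting with `A`.
DUALITY: `D : H ≃ H_h` with `τ_* (D (A a)) = D a`, `j_* (D (B a)) = D a`, `h_* (D (γ a)) = D a`.
HOMOLOGY SIDE (`H_h = H₂(X_s; ℚ)`, automorphisms `τ_*, j_*, h_*`): planes `W₁, W₂` of dimension `2`, `τ_*`-stable with `τ_*² = −1` on them,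
`j_* W₁ ⊆ W₂`, `j_* W₂ ⊆ W₁`; the two-ball variation `h_* y − y ∈ W₁ ⊔ W₂` for `τ_*² y = −y`; `h_* = τ_*` on `W₁`, `h_* τ_* = 1` on `W₂`;
and the disjoint-carrier orthogonality `Q a b = 0` whenever `D a ∈ W₁`, `D b ∈ W₂`.
CONCLUSION: the ∃-clause of `stub_monodromyBireflectionQ` (v6) for this `γ`, in the currency `(eigenspace (A^2) (−1)).baseChange L`. -/
theorem exists_bireflection_datum_of_homological_datum {Q : BilinForm K H} (hQs : ∀ x y, Q x y = Q y x) (hQn : Q.Nondegenerate)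
    {A B : H →ₗ[K] H} (haQ : ∀ x y, Q (A x) (A y) = Q x y) (hA4 : ∀ x, A (A (A (A x))) = x)
    (hQb : ∀ x y, Q (B x) (B y) = Q x y) (hBA : ∀ x, B (A (A x)) = A (A (B x))) (hBB : ∀ x, B (B x) = A (A x))
    (hABA : ∀ x, A (B (A x)) = B x) {γ : H ≃ₗ[K] H} (hγA : ∀ x, γ (A x) = A (γ x)) (hγQ : ∀ x y, Q (γ x) (γ y) = Q x y)
    (D : H ≃ₗ[K] Hh) (t js hm : Hh ≃ₗ[K] Hh) (hDA : ∀ a, t (D (A a)) = D a) (hDB : ∀ a, js (D (B a)) = D a)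
    (hDγ : ∀ a, hm (D (γ a)) = D a) (W₁ W₂ : Submodule K Hh) (hW₁ : finrank K W₁ = 2) (hW₂ : finrank K W₂ = 2)
    (htW₁ : ∀ w ∈ W₁, t w ∈ W₁) (htW₂ : ∀ w ∈ W₂, t w ∈ W₂) (htt₁ : ∀ w ∈ W₁, t (t w) = -w) (htt₂ : ∀ w ∈ W₂, t (t w) = -w)
    (hjW₁ : ∀ w ∈ W₁, js w ∈ W₂) (hjW₂ : ∀ w ∈ W₂, js w ∈ W₁) (hvar : ∀ y, t (t y) = -y → hm y - y ∈ W₁ ⊔ W₂)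
    (hh₁ : ∀ w ∈ W₁, hm w = t w) (hh₂ : ∀ w ∈ W₂, hm (t w) = w) (horth : ∀ a b, D a ∈ W₁ → D b ∈ W₂ → Q a b = 0)
    {i : L} (hi : i * i = -1) :
    ∃ ℓp ℓm : L ⊗[K] H, ℓp ∈ (Module.End.eigenspace (A ^ 2) (-1 : K)).baseChange L ∧
      ℓm ∈ (Module.End.eigenspace (A ^ 2) (-1 : K)).baseChange L ∧ A.baseChange L ℓp = i • ℓp ∧ A.baseChange L ℓm = i • ℓm ∧
      (Q.baseChange L) ℓp (B.baseChange L ℓm) ≠ 0 ∧ (γ.toLinearMap.baseChange L) ℓp = i • ℓp ∧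
      (γ.toLinearMap.baseChange L) ℓm = (-i) • ℓm ∧
      ∀ x ∈ (Module.End.eigenspace (A ^ 2) (-1 : K)).baseChange L, A.baseChange L x = i • x →
        (Q.baseChange L) x (B.baseChange L ℓp) = 0 → (Q.baseChange L) x (B.baseChange L ℓm) = 0 →
          (γ.toLinearMap.baseChange L) x = x := by
  -- ### the pulled-back planes
  let V₁ : Submodule K H := W₁.comap (D : H →ₗ[K] Hh)
  let V₂ : Submodule K H := W₂.comap (D : H →ₗ[K] Hh)
  have hm₁ : ∀ {a : H}, a ∈ V₁ ↔ D a ∈ W₁ := fun {a} => Submodule.mem_comap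
  have hm₂ : ∀ {a : H}, a ∈ V₂ ↔ D a ∈ W₂ := fun {a} => Submodule.mem_comap
  -- `D` in terms of the inverse automorphisms
  have hDA' : ∀ a, D (A a) = t.symm (D a) := fun a => by rw [← hDA a, LinearEquiv.symm_apply_apply]
  have hDB' : ∀ a, D (B a) = js.symm (D a) := fun a => by rw [← hDB a, LinearEquiv.symm_apply_apply]
  have hDγ' : ∀ a, D (γ a) = hm.symm (D a) := fun a => by rw [← hDγ a, LinearEquiv.symm_apply_apply]
  -- inverses on the planes: `t⁻¹ = −t`, `hm⁻¹ = t⁻¹` on `W₁`, `hm⁻¹ = t` on `W₂`; `js⁻¹ W₁ ⊆ W₂`, `js⁻¹ W₂ ⊆ W₁`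
  have htsymm₁ : ∀ w ∈ W₁, t.symm w = -t w := fun w hw => by
    apply t.injective
    rw [LinearEquiv.apply_symm_apply, map_neg, htt₁ w hw, neg_neg]
  have htsymm₂ : ∀ w ∈ W₂, t.symm w = -t w := fun w hw => by
    apply t.injective
    rw [LinearEquiv.apply_symm_apply, map_neg, htt₂ w hw, neg_neg]
  have hhsymm₁ : ∀ w ∈ W₁, hm.symm w = t.symm w := fun w hw => by
    apply hm.injective
    rw [LinearEquiv.apply_symm_apply, htsymm₁ w hw, map_neg, hh₁ _ (htW₁ w hw), htt₁ w hw, neg_neg]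
  have hhsymm₂ : ∀ w ∈ W₂, hm.symm w = t w := fun w hw => by
    apply hm.injective
    rw [LinearEquiv.apply_symm_apply, hh₂ w hw]
  have hjsymm₁ : ∀ w ∈ W₁, js.symm w ∈ W₂ := symm_mem_of_mapsTo_of_finrank_eq js W₁ W₂ hjW₂ (by rw [hW₁, hW₂])
  have hjsymm₂ : ∀ w ∈ W₂, js.symm w ∈ W₁ := symm_mem_of_mapsTo_of_finrank_eq js W₂ W₁ hjW₁ (by rw [hW₁, hW₂])
  -- the sum `W₁ ⊔ W₂` is `hm`-stable, hence `hm⁻¹`-stable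
  have hhW : ∀ w ∈ W₁ ⊔ W₂, hm w ∈ W₁ ⊔ W₂ := by
    intro w hw
    obtain ⟨w₁, h₁, w₂, h₂, rfl⟩ := Submodule.mem_sup.1 hw
    have h₂' : t.symm w₂ ∈ W₂ := symm_mem_of_mapsTo t W₂ htW₂ w₂ h₂
    have e₂ : hm w₂ = t.symm w₂ := by
      have h := hh₂ _ h₂'
      rw [LinearEquiv.apply_symm_apply] at h
      exact h
    rw [map_add, hh₁ w₁ h₁, e₂]
    exact Submodule.add_mem_sup (htW₁ w₁ h₁) h₂'
  have hhWsymm : ∀ w ∈ W₁ ⊔ W₂, hm.symm w ∈ W₁ ⊔ W₂ := symm_mem_of_mapsTo hm (W₁ ⊔ W₂) hhW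
  -- ### the hypotheses of `exists_bireflection_datum_of_localMonodromy_sq` for `V₁, V₂`
  have hmemE : ∀ {a : H}, a ∈ Module.End.eigenspace (A ^ 2) (-1 : K) ↔ A (A a) = -a := fun {a} => by
    rw [Module.End.mem_eigenspace_iff, pow_two, Module.End.mul_apply, neg_one_smul]
  have hAV₁ : ∀ a ∈ V₁, A a ∈ V₁ := fun a ha =>
    hm₁.2 (by rw [hDA']; exact symm_mem_of_mapsTo t W₁ htW₁ _ (hm₁.1 ha))
  have hAV₂ : ∀ a ∈ V₂, A a ∈ V₂ := fun a ha =>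
    hm₂.2 (by rw [hDA']; exact symm_mem_of_mapsTo t W₂ htW₂ _ (hm₂.1 ha))
  have haa₁ : ∀ a ∈ V₁, A (A a) = -a := fun a ha => by
    apply D.injective
    have h1 : D a ∈ W₁ := hm₁.1 ha
    have h2 : t.symm (D a) ∈ W₁ := symm_mem_of_mapsTo t W₁ htW₁ _ h1
    rw [hDA', hDA', map_neg, htsymm₁ _ h2, htsymm₁ _ h1, map_neg, htt₁ _ h1, neg_neg]
  have haa₂ : ∀ a ∈ V₂, A (A a) = -a := fun a ha => by
    apply D.injective
    have h1 : D a ∈ W₂ := hm₂.1 ha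
    have h2 : t.symm (D a) ∈ W₂ := symm_mem_of_mapsTo t W₂ htW₂ _ h1
    rw [hDA', hDA', map_neg, htsymm₂ _ h2, htsymm₂ _ h1, map_neg, htt₂ _ h1, neg_neg]
  have hBV₁ : ∀ a ∈ V₁, B a ∈ V₂ := fun a ha => hm₂.2 (by rw [hDB']; exact hjsymm₁ _ (hm₁.1 ha))
  have hBV₂ : ∀ a ∈ V₂, B a ∈ V₁ := fun a ha => hm₁.2 (by rw [hDB']; exact hjsymm₂ _ (hm₂.1 ha))
  have hbb₁ : ∀ a ∈ V₁, B (B a) = -a := fun a ha => by rw [hBB]; exact haa₁ a ha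
  have hbb₂ : ∀ a ∈ V₂, B (B a) = -a := fun a ha => by rw [hBB]; exact haa₂ a ha
  have hab₁ : ∀ a ∈ V₁, A (B a) = -B (A a) := fun a ha => by
    have h := hABA (A a)
    rw [haa₁ a ha, map_neg, map_neg] at h
    rw [← h, neg_neg]
  have hab₂ : ∀ a ∈ V₂, A (B a) = -B (A a) := fun a ha => by
    have h := hABA (A a)
    rw [haa₂ a ha, map_neg, map_neg] at h
    rw [← h, neg_neg]
  have horth' : ∀ a ∈ V₁, ∀ b ∈ V₂, Q a b = 0 := fun a ha b hb => horth a b (hm₁.1 ha) (hm₂.1 hb)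
  have hdim₁ : finrank K V₁ = 2 := by
    show finrank K (W₁.comap (D : H →ₗ[K] Hh)) = 2
    rw [Submodule.comap_equiv_eq_map_symm, LinearEquiv.finrank_map_eq, hW₁]
  have hdim₂ : finrank K V₂ = 2 := by
    show finrank K (W₂.comap (D : H →ₗ[K] Hh)) = 2
    rw [Submodule.comap_equiv_eq_map_symm, LinearEquiv.finrank_map_eq, hW₂]
  have hV₁E : V₁ ≤ Module.End.eigenspace (A ^ 2) (-1 : K) := fun a ha => hmemE.2 (haa₁ a ha)
  have hV₂E : V₂ ≤ Module.End.eigenspace (A ^ 2) (-1 : K) := fun a ha => hmemE.2 (haa₂ a ha)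
  -- the shape on `ker(A² + 1)`
  have hγV : ∀ a, A (A a) = -a → γ a - a ∈ V₁ ⊔ V₂ := by
    intro a hAA
    have hy : t (t (D a)) = -(D a) := by
      have h := congrArg D hAA
      rw [hDA', hDA', map_neg] at h
      have h' := congrArg (fun z => t (t z)) h
      simp only [LinearEquiv.apply_symm_apply, map_neg] at h'
      have h'' := congrArg Neg.neg h'
      rw [neg_neg] at h''
      exact h''.symm
    have hv := hvar (D a) hy
    have hD : D (γ a - a) ∈ W₁ ⊔ W₂ := by
      rw [map_sub, hDγ']
      have e : hm.symm (D a) - D a = -(hm.symm (hm (D a) - D a)) := by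
        rw [map_sub, LinearEquiv.symm_apply_apply, neg_sub]
      rw [e]
      exact Submodule.neg_mem _ (hhWsymm _ hv)
    obtain ⟨w₁, h₁, w₂, h₂, hsum⟩ := Submodule.mem_sup.1 hD
    have e : γ a - a = D.symm w₁ + D.symm w₂ := by
      apply D.injective
      rw [map_add, LinearEquiv.apply_symm_apply, LinearEquiv.apply_symm_apply, hsum]
    rw [e]
    exact Submodule.add_mem_sup (hm₁.2 (by rw [LinearEquiv.apply_symm_apply]; exact h₁))
      (hm₂.2 (by rw [LinearEquiv.apply_symm_apply]; exact h₂))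
  have hγ₁ : ∀ a ∈ V₁, γ a = A a := fun a ha => by
    apply D.injective
    rw [hDγ', hDA', hhsymm₁ _ (hm₁.1 ha)]
  have hγ₂ : ∀ a ∈ V₂, γ a = -A a := fun a ha => by
    apply D.injective
    rw [hDγ', map_neg, hDA', hhsymm₂ _ (hm₂.1 ha), htsymm₂ _ (hm₂.1 ha), neg_neg]
  exact exists_bireflection_datum_of_localMonodromy_sq hQs hQn haQ hA4 hQb hBA hγA hγQ V₁ V₂
    (Module.End.eigenspace (A ^ 2) (-1 : K)) hV₁E hV₂E le_rfl hdim₁ hdim₂ hAV₁ hAV₂ haa₁ haa₂ hBV₁ hBV₂ hbb₁ hbb₂ hab₁ hab₂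
    horth' hγV hγ₁ hγ₂ hi

end Homological

/-! ### §3 The duality squares from the cap-product projection formula; the datum with `D` = Poincaré duality -/

section PoincareDuality

open Literature.AlgebraicTopology.SingularHomology

variable {R : Type} [CommRing R] {X : Type} [TopologicalSpace X] {p q n : ℕ}

/-- **The duality square** `f_* (D (f^* a)) = D a` for the Poincaré duality map `D a = a ⌢ [X]` of an `R`-orientation `μ` and a self-map
`f` fixing the fundamental class (`f_* [X] = [X]`, e.g. an orientation-preserving homeomorphism): the projection formula
`f_*(f^* a ⌢ c) = a ⌢ f_* c` (`capProduct_map`). This discharges the hypotheses `hDA`, `hDB`, `hDγ` of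
`exists_bireflection_datum_of_homological_datum` for `D` = Poincaré duality. -/
theorem map_poincareDualityMap_map (μ : HomologicalOrientation R X n) (h : p + q = n) (f : C(X, X))
    (hf : singularHomology.map R R f n μ.fundamentalClass = μ.fundamentalClass) (a : singularCohomology R R X p) :
    singularHomology.map R R f q (poincareDualityMap μ h (singularCohomology.map R R f p a)) = poincareDualityMap μ h a := by
  rw [poincareDualityMap_apply, poincareDualityMap_apply, capProduct_map, hf]

/-- **Stub S5 (v6 currency) from the homological two-ball datum, with `D` = POINCARÉ DUALITY of a rational orientation `μ` of the
(4-dimensional) space `X`** (bijective: Hatcher Thm. 3.30, the tree's named fact `bijective_poincareDualityMap`), for homeomorphisms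
`τ, j, h` of `X` fixing `[X]` (orientation-preserving): `A = τ^*`, `B = j^*`, `γ = h^*` on `H²(X; ℚ)`, `τ_*, j_*, h_*` on `H₂(X; ℚ)`;
the three duality squares are `map_poincareDualityMap_map`. The remaining hypotheses are those of
`exists_bireflection_datum_of_homological_datum` (symmetric non-degenerate `Q` with `A, B, γ` isometries and the deck relations;
the planes `W₁, W₂ ≤ H₂(X; ℚ)`; the disjoint-carrier orthogonality stated through `D`). -/
theorem exists_bireflection_datum_of_homological_datum_poincare {L : Type} [Field L] [CharZero L] [Algebra ℚ L]
    [FiniteDimensional ℚ (singularCohomology ℚ ℚ X 2)] [FiniteDimensional ℚ (singularHomology ℚ ℚ X 2)]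
    (μ : HomologicalOrientation ℚ X 4) (hPD : Function.Bijective (poincareDualityMap μ (show 2 + 2 = 4 by norm_num)))
    {Q : BilinForm ℚ (singularCohomology ℚ ℚ X 2)} (hQs : ∀ x y, Q x y = Q y x) (hQn : Q.Nondegenerate) (τ j h : X ≃ₜ X)
    (hτμ : singularHomology.map ℚ ℚ (τ : C(X, X)) 4 μ.fundamentalClass = μ.fundamentalClass)
    (hjμ : singularHomology.map ℚ ℚ (j : C(X, X)) 4 μ.fundamentalClass = μ.fundamentalClass)
    (hhμ : singularHomology.map ℚ ℚ (h : C(X, X)) 4 μ.fundamentalClass = μ.fundamentalClass)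
    (haQ : ∀ x y, Q ((singularCohomology.map ℚ ℚ (τ : C(X, X)) 2).hom x) ((singularCohomology.map ℚ ℚ (τ : C(X, X)) 2).hom y) = Q x y)
    (hA4 : ∀ x, (singularCohomology.map ℚ ℚ (τ : C(X, X)) 2).hom ((singularCohomology.map ℚ ℚ (τ : C(X, X)) 2).hom
      ((singularCohomology.map ℚ ℚ (τ : C(X, X)) 2).hom ((singularCohomology.map ℚ ℚ (τ : C(X, X)) 2).hom x))) = x)
    (hQb : ∀ x y, Q ((singularCohomology.map ℚ ℚ (j : C(X, X)) 2).hom x) ((singularCohomology.map ℚ ℚ (j : C(X, X)) 2).hom y) = Q x y)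
    (hBA : ∀ x, (singularCohomology.map ℚ ℚ (j : C(X, X)) 2).hom ((singularCohomology.map ℚ ℚ (τ : C(X, X)) 2).hom
      ((singularCohomology.map ℚ ℚ (τ : C(X, X)) 2).hom x)) = (singularCohomology.map ℚ ℚ (τ : C(X, X)) 2).hom
      ((singularCohomology.map ℚ ℚ (τ : C(X, X)) 2).hom ((singularCohomology.map ℚ ℚ (j : C(X, X)) 2).hom x)))
    (hBB : ∀ x, (singularCohomology.map ℚ ℚ (j : C(X, X)) 2).hom ((singularCohomology.map ℚ ℚ (j : C(X, X)) 2).hom x) =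
      (singularCohomology.map ℚ ℚ (τ : C(X, X)) 2).hom ((singularCohomology.map ℚ ℚ (τ : C(X, X)) 2).hom x))
    (hABA : ∀ x, (singularCohomology.map ℚ ℚ (τ : C(X, X)) 2).hom ((singularCohomology.map ℚ ℚ (j : C(X, X)) 2).hom
      ((singularCohomology.map ℚ ℚ (τ : C(X, X)) 2).hom x)) = (singularCohomology.map ℚ ℚ (j : C(X, X)) 2).hom x)
    (hγA : ∀ x, (singularCohomology.map ℚ ℚ (h : C(X, X)) 2).hom ((singularCohomology.map ℚ ℚ (τ : C(X, X)) 2).hom x) =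
      (singularCohomology.map ℚ ℚ (τ : C(X, X)) 2).hom ((singularCohomology.map ℚ ℚ (h : C(X, X)) 2).hom x))
    (hγQ : ∀ x y, Q ((singularCohomology.map ℚ ℚ (h : C(X, X)) 2).hom x) ((singularCohomology.map ℚ ℚ (h : C(X, X)) 2).hom y) = Q x y)
    (W₁ W₂ : Submodule ℚ (singularHomology ℚ ℚ X 2)) (hW₁ : finrank ℚ W₁ = 2) (hW₂ : finrank ℚ W₂ = 2)
    (htW₁ : ∀ w ∈ W₁, singularHomology.map ℚ ℚ (τ : C(X, X)) 2 w ∈ W₁) (htW₂ : ∀ w ∈ W₂, singularHomology.map ℚ ℚ (τ : C(X, X)) 2 w ∈ W₂)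
    (htt₁ : ∀ w ∈ W₁, singularHomology.map ℚ ℚ (τ : C(X, X)) 2 (singularHomology.map ℚ ℚ (τ : C(X, X)) 2 w) = -w)
    (htt₂ : ∀ w ∈ W₂, singularHomology.map ℚ ℚ (τ : C(X, X)) 2 (singularHomology.map ℚ ℚ (τ : C(X, X)) 2 w) = -w)
    (hjW₁ : ∀ w ∈ W₁, singularHomology.map ℚ ℚ (j : C(X, X)) 2 w ∈ W₂) (hjW₂ : ∀ w ∈ W₂, singularHomology.map ℚ ℚ (j : C(X, X)) 2 w ∈ W₁)
    (hvar : ∀ y, singularHomology.map ℚ ℚ (τ : C(X, X)) 2 (singularHomology.map ℚ ℚ (τ : C(X, X)) 2 y) = -y →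
      singularHomology.map ℚ ℚ (h : C(X, X)) 2 y - y ∈ W₁ ⊔ W₂)
    (hh₁ : ∀ w ∈ W₁, singularHomology.map ℚ ℚ (h : C(X, X)) 2 w = singularHomology.map ℚ ℚ (τ : C(X, X)) 2 w)
    (hh₂ : ∀ w ∈ W₂, singularHomology.map ℚ ℚ (h : C(X, X)) 2 (singularHomology.map ℚ ℚ (τ : C(X, X)) 2 w) = w)
    (horth : ∀ a b, poincareDualityMap μ (show 2 + 2 = 4 by norm_num) a ∈ W₁ → poincareDualityMap μ (show 2 + 2 = 4 by norm_num) b ∈ W₂ →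
      Q a b = 0)
    {i : L} (hi : i * i = -1) :
    ∃ ℓp ℓm : L ⊗[ℚ] singularCohomology ℚ ℚ X 2,
      ℓp ∈ (Module.End.eigenspace ((singularCohomology.map ℚ ℚ (τ : C(X, X)) 2).hom ^ 2) (-1 : ℚ)).baseChange L ∧
      ℓm ∈ (Module.End.eigenspace ((singularCohomology.map ℚ ℚ (τ : C(X, X)) 2).hom ^ 2) (-1 : ℚ)).baseChange L ∧
      (singularCohomology.map ℚ ℚ (τ : C(X, X)) 2).hom.baseChange L ℓp = i • ℓp ∧
      (singularCohomology.map ℚ ℚ (τ : C(X, X)) 2).hom.baseChange L ℓm = i • ℓm ∧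
      (Q.baseChange L) ℓp ((singularCohomology.map ℚ ℚ (j : C(X, X)) 2).hom.baseChange L ℓm) ≠ 0 ∧
      ((singularCohomology.mapIso ℚ ℚ h 2).toLinearEquiv.toLinearMap.baseChange L) ℓp = i • ℓp ∧
      ((singularCohomology.mapIso ℚ ℚ h 2).toLinearEquiv.toLinearMap.baseChange L) ℓm = (-i) • ℓm ∧
      ∀ x ∈ (Module.End.eigenspace ((singularCohomology.map ℚ ℚ (τ : C(X, X)) 2).hom ^ 2) (-1 : ℚ)).baseChange L,
        (singularCohomology.map ℚ ℚ (τ : C(X, X)) 2).hom.baseChange L x = i • x →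
        (Q.baseChange L) x ((singularCohomology.map ℚ ℚ (j : C(X, X)) 2).hom.baseChange L ℓp) = 0 →
        (Q.baseChange L) x ((singularCohomology.map ℚ ℚ (j : C(X, X)) 2).hom.baseChange L ℓm) = 0 →
          ((singularCohomology.mapIso ℚ ℚ h 2).toLinearEquiv.toLinearMap.baseChange L) x = x := by
  -- the duality isomorphism and the homology automorphisms
  let D : singularCohomology ℚ ℚ X 2 ≃ₗ[ℚ] singularHomology ℚ ℚ X 2 := LinearEquiv.ofBijective (poincareDualityMap μ _) hPD
  have hD : ∀ a, D a = poincareDualityMap μ (show 2 + 2 = 4 by norm_num) a := fun a => rfl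
  let t : singularHomology ℚ ℚ X 2 ≃ₗ[ℚ] singularHomology ℚ ℚ X 2 := (singularHomology.mapIso ℚ ℚ τ 2).toLinearEquiv
  let js : singularHomology ℚ ℚ X 2 ≃ₗ[ℚ] singularHomology ℚ ℚ X 2 := (singularHomology.mapIso ℚ ℚ j 2).toLinearEquiv
  let hm : singularHomology ℚ ℚ X 2 ≃ₗ[ℚ] singularHomology ℚ ℚ X 2 := (singularHomology.mapIso ℚ ℚ h 2).toLinearEquiv
  have ht : ∀ w, t w = singularHomology.map ℚ ℚ (τ : C(X, X)) 2 w := fun w => rfl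
  have hjs : ∀ w, js w = singularHomology.map ℚ ℚ (j : C(X, X)) 2 w := fun w => rfl
  have hhm : ∀ w, hm w = singularHomology.map ℚ ℚ (h : C(X, X)) 2 w := fun w => rfl
  let γ : singularCohomology ℚ ℚ X 2 ≃ₗ[ℚ] singularCohomology ℚ ℚ X 2 := (singularCohomology.mapIso ℚ ℚ h 2).toLinearEquiv
  have hγ : ∀ a, γ a = (singularCohomology.map ℚ ℚ (h : C(X, X)) 2).hom a := fun a => rfl
  exact exists_bireflection_datum_of_homological_datum (L := L) hQs hQn haQ hA4 hQb hBA hBB hABA (γ := γ)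
    (fun x => by rw [hγ, hγ]; exact hγA x) (fun x y => by rw [hγ, hγ]; exact hγQ x y) D t js hm
    (fun a => by rw [ht, hD, hD]; exact map_poincareDualityMap_map μ _ (τ : C(X, X)) hτμ a)
    (fun a => by rw [hjs, hD, hD]; exact map_poincareDualityMap_map μ _ (j : C(X, X)) hjμ a)
    (fun a => by rw [hhm, hD, hD, hγ]; exact map_poincareDualityMap_map μ _ (h : C(X, X)) hhμ a)
    W₁ W₂ hW₁ hW₂ (fun w hw => by rw [ht]; exact htW₁ w hw) (fun w hw => by rw [ht]; exact htW₂ w hw)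
    (fun w hw => by rw [ht, ht]; exact htt₁ w hw) (fun w hw => by rw [ht, ht]; exact htt₂ w hw)
    (fun w hw => by rw [hjs]; exact hjW₁ w hw) (fun w hw => by rw [hjs]; exact hjW₂ w hw)
    (fun y hy => by rw [hhm]; rw [ht, ht] at hy; exact hvar y hy)
    (fun w hw => by rw [hhm, ht]; exact hh₁ w hw) (fun w hw => by rw [hhm, ht]; exact hh₂ w hw)
    (fun a b ha hb => horth a b (by rw [← hD]; exact ha) (by rw [← hD]; exact hb)) hi

end PoincareDuality

/-! ### §4 The duality square for the deck transformations of a smooth projective surface, on S5's own carrier -/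

section Deck

open Literature.AlgebraicTopology.SingularHomology Literature.AlgebraicGeometry Literature.AlgebraicGeometry.HodgeTheory
open Literature.AlgebraicGeometry.Motives

/-- **The duality square for an automorphism of a smooth projective surface**, on `H²(X(ℂ); ℚ) = bettiCohomology X 2` with the rational
complex orientation: `τ(ℂ)_* (D (τ^* a)) = D a`, `D a = a ⌢ [X(ℂ)]` — `τ(ℂ)` fixes `[X(ℂ)]` (`map_fundamentalClass_complexOrientationRat_of_iso`,
degree `1`) and the cap-product projection formula. Here `τ^*` is literally S5's `pull τ 2` (`bettiCohomology.map` is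
`singularCohomology.map` of `AlgPoints.mapContinuous`). -/
theorem map_poincareDualityMap_pull_of_iso {X : Motives.SchemeOver ℂ} (hX : Motives.IsSmoothProjective 2 X) (τ : X ≅ X)
    (a : Motives.bettiCohomology X 2) :
    singularHomology.map ℚ ℚ (AlgPoints.mapContinuous (L := ℂ) τ.hom) 2
        (poincareDualityMap (complexOrientationRat hX) (show 2 + 2 = 2 * 2 by norm_num) ((Motives.bettiCohomology.map τ.hom 2).hom a)) =
      poincareDualityMap (complexOrientationRat hX) (show 2 + 2 = 2 * 2 by norm_num) a :=
  map_poincareDualityMap_map (complexOrientationRat hX) _ (AlgPoints.mapContinuous (L := ℂ) τ.hom)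
    (map_fundamentalClass_complexOrientationRat_of_iso hX hX τ) a

end Deck

end Summit.HodgeConjecture.HodgeConjecture.Theorems.Q8BireflectionRecognitionHomological

end
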